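import Mathlib.Data.Fintype.Sum
import Literature.ModelTheory.FiniteModelTheory.StructCkEquiv
import HarnessLib

/-!
# The `k`-variable counting logic `C^k` and HELLA'S THEOREM (proved): the bijective pebble game
characterises `C^k`-equivalence of finite structures

Topic `Literature/ModelTheory/FiniteModelTheory`; follow-up to definition requests `defn-CkEquiv`
/ `defn-CountingWidth` ("pick ONE rendering of `≡_{C^k}` and record the others as equivalence
facts") — here the logical rendering is DEFINED and its equivalence with the game is PROVED.

* SYNTAX `CFormula L k` of `C^k` over a (relational) vocabulary `L`: variables `x₀, …, x_{k-1}`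
  (re-usable), atoms `R(x_{t 0}, …)` and `xᵢ = xⱼ`, `⊥`, `¬`, `∧`, and the COUNTING QUANTIFIERS
  `∃^{≥ m} xᵢ φ`; SEMANTICS `CFormula.Realize` (`∃^{≥ m}` via `Set.encard`), free variables,
  sentences, the coincidence lemma `realize_congr`, invariance under isomorphism
  `realize_equiv`; `CkSentenceEquiv L k M N` — `M`, `N` satisfy the same `C^k` sentences.
* **HELLA'S THEOREM** `structCkEquiv_iff_ckSentenceEquiv`: for finite nonempty `L`-structures,
  `StructCkEquiv L k M N ↔ CkSentenceEquiv L k M N` (game ⇒ logic, `StructCkEquiv.ckSentenceEquiv`,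
  for all structures). Corollary `ckEquiv_iff_ckSentenceEquiv`: the tree's `CkEquiv k G H` of
  finite nonempty graphs IS agreement on `C^k` sentences of `Language.graph`. The proof is the
  classical one (Cai–Fürer–Immerman 1992, proof of Thm 5.2; Libkin 2004, Thm 11.5 for the
  counting-free game): along a strategy space formulas transfer by induction on syntax, the
  counting quantifier through Duplicator's bijection (`realize_iff_of_ofFun_mem`); conversely
  the positions all of whose extensions satisfy the same `C^k` formulas with free variables among
  the pebbled indices (`typePositions`) form a strategy space: at a move, the `C^k`-TYPES of the
  element to be pebbled (over the finitely many relevant formulas) are each defined by ONE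
  formula on finite structures (`exists_formula_defining_typeAt`), the counting sentences
  `∃^{≥ m} xᵢ ψ_τ` force equal class sizes in `M` and `N`, and Duplicator's bijection is glued
  from bijections of the classes (`typePositions_move`).
* Consequences: `CkSentenceEquiv`/`StructCkEquiv` are symmetric and transitive on finite nonempty
  structures, and the tree's `CkEquiv` is TRANSITIVE on finite nonempty graphs (`CkEquiv.trans`,
  deferred in `CkEquiv.lean`).
* `exists_definesOn_iff_ckEquiv_invariant` (PROVED): on graphs with vertex set `Fin n`, `n ≥ 1`, a
  class is defined by a `C^k` sentence (`DefinesOn`) iff it is a union of `CkEquiv k`-classes —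
  the passage between the printed form of the counting-width lower bounds (Atserias–Dawar–
  Ochremiak, Dawar–Wang: "every `C^k` sentence defining the class has `k ≥ …`") and the witness
  form used in `CountingWidth.lean`.

Hella states the theorem for `C^k_{∞ω}` and arbitrary structures; on finite structures
`C^k_{∞ω}`- and `C^k`-equivalence coincide, and this finitary form is the one used by
Cai–Fürer–Immerman, Atserias–Dawar(–Ochremiak), Dawar–Wilsenach. RELATIONAL READING: both
`StructCkEquiv` (partial isomorphisms inspect relation symbols only) and `CFormula` (atoms are
`R(x̄)` and `xᵢ = xⱼ`; no function terms) ignore function and constant symbols, so the theorem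
below holds for every `L` as stated, but it is the printed theorem only for RELATIONAL `L`
(`[L.IsRelational]`), the setting of all cited sources. NOT here: `k`-dimensional
Weisfeiler–Leman refinement (CFI Thm 5.2's third characterisation).

## References

* L. Hella, *Logical hierarchies in PTIME*, Inform. and Comput. 129 (1996) 1–19 (paywalled,
  acq-02317; the theorem is restated in the next two items).
* A. Atserias, A. Dawar, *Definable inapproximability*, J. Logic Comput. 29 (2019), §2.1 (`C^k` =
  `k`-variable fragment of first-order logic with counting quantifiers `∃^{≥ i}`; "𝔄 ≡_{C^k} 𝔅
  if, and only if, Duplicator has a winning strategy in the k-pebble bijective game"). Read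
  arXiv:1806.11307 pp. 6–7.
* M. Grohe, M. Otto, *Pebble games and linear equations*, J. Symb. Log. 80 (2015), Thm 2.2.
* J.-Y. Cai, M. Fürer, N. Immerman, Combinatorica 12 (1992), §4 (the languages `C_k`), Lemma 4.4,
  Thm 5.2 and its proof. Read (FOCS 1989 version) pp. 12–14.
* L. Libkin, *Elements of Finite Model Theory* (2004), §8.1 (counting quantifiers), Thm 11.5.
-/

namespace Literature.ModelTheory.FiniteModelTheory

open FirstOrder FirstOrder.Language.Structure

/-! ### The `k`-variable counting logic `C^k` -/

universe u' v' w₁ w₂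

/-- **Formulas of the `k`-variable counting logic `C^k`** over a (relational) vocabulary `L`: the
variables are `x₀, …, x_{k-1}` (indices `Fin k`), atoms are `R(x_{t 0}, …, x_{t (r-1)})` for
relation symbols `R` (function and constant symbols are not used: relational setting) and
`xᵢ = xⱼ`; connectives `⊥`, `¬`, `∧`; and the COUNTING QUANTIFIERS `∃^{≥ m} xᵢ φ` ("there are at
least `m` elements `xᵢ` such that `φ`"), which re-bind `xᵢ`. (`∃ = ∃^{≥1}`, `∀`, `∨`, `∃^{= m}` are
definable without extra variables, so this syntax has the full expressive power of `C^k` at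
each `k`.) [Cai–Fürer–Immerman 1992, §4 (the languages `C_k`); Atserias–Dawar 2019, §2.1;
Libkin 2004, §8.1 (counting quantifiers)] [cite: CaiFurerImmerman1992, §4] -/
inductive CFormula (L : FirstOrder.Language.{u', v'}) (k : ℕ) : Type v'
  /-- relational atom `R(x_{t 0}, …)` -/
  | rel {r : ℕ} (R : L.Relations r) (t : Fin r → Fin k) : CFormula L k
  /-- equality atom `xᵢ = xⱼ` -/
  | equal (i j : Fin k) : CFormula L k
  /-- falsum -/
  | falsum : CFormula L k
  /-- negation -/
  | not (φ : CFormula L k) : CFormula L k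
  /-- conjunction -/
  | and (φ ψ : CFormula L k) : CFormula L k
  /-- counting quantifier `∃^{≥ m} xᵢ φ` -/
  | existsGE (m : ℕ) (i : Fin k) (φ : CFormula L k) : CFormula L k

namespace CFormula

variable {L : FirstOrder.Language.{u', v'}} {k : ℕ}

/-- `⊥` as the default formula. [folklore] -/
instance : Inhabited (CFormula L k) := ⟨falsum⟩

/-- SEMANTICS of `C^k`: `φ.Realize v` for an assignment `v : Fin k → M` of the `k` variables in an
`L`-structure `M`; `∃^{≥ m} xᵢ φ` holds iff the set of `a : M` with `φ[xᵢ ↦ a]` has at least `m`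
elements (`Set.encard`, so infinite witness sets count as `≥ m`). [Cai–Fürer–Immerman 1992, §4;
Libkin 2004, §8.1] [folklore] -/
def Realize {M : Type w₁} [L.Structure M] : CFormula L k → (Fin k → M) → Prop
  | rel R t, v => RelMap R (v ∘ t)
  | equal i j, v => v i = v j
  | falsum, _ => False
  | not φ, v => ¬ φ.Realize v
  | and φ ψ, v => φ.Realize v ∧ ψ.Realize v
  | existsGE m i φ, v => (m : ℕ∞) ≤ {a : M | φ.Realize (Function.update v i a)}.encard

/-- The FREE VARIABLES of a `C^k` formula (`∃^{≥ m} xᵢ` binds `xᵢ`). [Libkin 2004, §11.1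
(finite-variable logics: variables may be re-used)] [folklore] -/
def freeVars : CFormula L k → Finset (Fin k)
  | rel _ t => Finset.univ.image t
  | equal i j => {i, j}
  | falsum => ∅
  | not φ => φ.freeVars
  | and φ ψ => φ.freeVars ∪ ψ.freeVars
  | existsGE _ i φ => φ.freeVars.erase i

/-- A SENTENCE of `C^k`: no free variables. [folklore] -/
def IsSentence (φ : CFormula L k) : Prop := φ.freeVars = ∅

/-- The realisation of a formula depends only on the values of its free variables. [Libkin
2004, §2.1 (coincidence lemma)] [folklore] -/
theorem realize_congr {M : Type w₁} [L.Structure M] :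
    ∀ (φ : CFormula L k) {v v' : Fin k → M}, (∀ i ∈ φ.freeVars, v i = v' i) →
      (φ.Realize v ↔ φ.Realize v')
  | rel R t, v, v', h => by
    have : v ∘ t = v' ∘ t := funext fun j => h (t j) (by simp [freeVars])
    simp only [Realize, this]
  | equal i j, v, v', h => by
    simp only [Realize, h i (by simp [freeVars]), h j (by simp [freeVars])]
  | falsum, _, _, _ => Iff.rfl
  | not φ, v, v', h => not_congr (realize_congr φ h)
  | and φ ψ, v, v', h =>
    and_congr (realize_congr φ fun i hi => h i (by simp [freeVars, hi]))
      (realize_congr ψ fun i hi => h i (by simp [freeVars, hi]))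
  | existsGE m i φ, v, v', h => by
    have key : ∀ a : M, φ.Realize (Function.update v i a) ↔ φ.Realize (Function.update v' i a) :=
      fun a => realize_congr φ fun j hj => by
        by_cases hji : j = i
        · subst hji; simp
        · rw [Function.update_of_ne hji, Function.update_of_ne hji]
          exact h j (by simp [freeVars, hj, hji])
    simp only [Realize, key]

/-- Hence a sentence has the same truth value under all assignments. [folklore] -/
theorem IsSentence.realize_iff {M : Type w₁} [L.Structure M] {φ : CFormula L k}
    (hφ : φ.IsSentence) (v v' : Fin k → M) : φ.Realize v ↔ φ.Realize v' :=
  realize_congr φ fun i hi => by simp [IsSentence] at hφ; simp [hφ] at hi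

end CFormula

/-- **`C^k`-EQUIVALENCE, LOGICAL FORM**: the `L`-structures `M` and `N` satisfy the same SENTENCES
of `C^k` (under any assignments — immaterial for sentences, `IsSentence.realize_iff`; note the
statement is vacuous in `M` or `N` when that carrier is empty and `k ≥ 1`, and Hella's theorem
below is stated for nonempty finite structures). [Cai–Fürer–Immerman 1992, §4;
Atserias–Dawar 2019, §2.1 (`≡_{C^k}`)] [cite: AtseriasDawar2019, §2.1] -/
def CkSentenceEquiv (L : FirstOrder.Language.{u', v'}) (k : ℕ) (M : Type w₁) (N : Type w₂)
    [L.Structure M] [L.Structure N] : Prop :=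
  ∀ φ : CFormula L k, φ.IsSentence → ∀ (v : Fin k → M) (w : Fin k → N), (φ.Realize v ↔ φ.Realize w)

/-- Isomorphic structures satisfy the same `C^k` formulas along the isomorphism (so the same
sentences). [Libkin 2004, §2.1 (isomorphism invariance)] [folklore] -/
theorem CFormula.realize_equiv {L : FirstOrder.Language.{u', v'}} {k : ℕ} {M : Type w₁}
    {N : Type w₂} [L.Structure M] [L.Structure N] (e : M ≃[L] N) :
    ∀ (φ : CFormula L k) (v : Fin k → M), φ.Realize v ↔ φ.Realize (e ∘ v)
  | .rel R t, v => (e.map_rel R (v ∘ t)).symm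
  | .equal i j, v => e.injective.eq_iff.symm
  | .falsum, _ => Iff.rfl
  | .not φ, v => not_congr (CFormula.realize_equiv e φ v)
  | .and φ ψ, v => and_congr (CFormula.realize_equiv e φ v) (CFormula.realize_equiv e ψ v)
  | .existsGE m i φ, v => by
    simp only [CFormula.Realize]
    have hset : {b : N | φ.Realize (Function.update (e ∘ v) i b)} =
        e '' {a : M | φ.Realize (Function.update v i a)} := by
      ext b
      simp only [Set.mem_setOf_eq, Set.mem_image]
      constructor
      · intro hb
        refine ⟨e.symm b, ?_, e.apply_symm_apply b⟩
        rw [CFormula.realize_equiv e φ, Function.comp_update, e.apply_symm_apply]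
        exact hb
      · rintro ⟨a, ha, rfl⟩
        rw [CFormula.realize_equiv e φ, Function.comp_update] at ha
        exact ha
    rw [hset, e.injective.encard_image]

/-- Isomorphic structures are `C^k`-equivalent in the logical sense. [folklore] -/
theorem CkSentenceEquiv.of_equiv {L : FirstOrder.Language.{u', v'}} {M : Type w₁} {N : Type w₂}
    [L.Structure M] [L.Structure N] (e : M ≃[L] N) (k : ℕ) : CkSentenceEquiv L k M N :=
  fun φ hφ v w => (CFormula.realize_equiv e φ v).trans (hφ.realize_iff (e ∘ v) w)


/-! ### Hella's theorem: the game characterises `C^k`-equivalence (finite structures) -/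

section Hella

variable {L : FirstOrder.Language.{u', v'}} {k : ℕ} {M : Type w₁} {N : Type w₂}
  [L.Structure M] [L.Structure N]

namespace PebblePosition

/-- The position with every pair `i` on `(v i, w i)`. [folklore] -/
def ofFun (v : Fin k → M) (w : Fin k → N) : PebblePosition k M N := fun i => some (v i, w i)

/-- Moving pair `i` of a full position. [folklore] -/
theorem update_ofFun (v : Fin k → M) (w : Fin k → N) (i : Fin k) (a : M) (b : N) :
    Function.update (ofFun v w) i (some (a, b)) =
      ofFun (Function.update v i a) (Function.update w i b) := by
  funext j
  by_cases h : j = i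
  · subst h; simp [ofFun]
  · simp [ofFun, Function.update_of_ne h]

/-- The pairs of a full position are pebbled. [folklore] -/
theorem pebbled_ofFun (v : Fin k → M) (w : Fin k → N) (i : Fin k) :
    (ofFun v w).Pebbled (v i) (w i) := ⟨i, rfl⟩

/-- The pebbled indices of a position. [folklore] -/
def dom (p : PebblePosition k M N) : Finset (Fin k) := Finset.univ.filter fun j => (p j).isSome

/-- `v`, `w` EXTEND the position `p`: they agree with the pebbled pairs. [folklore] -/
def Extends (p : PebblePosition k M N) (v : Fin k → M) (w : Fin k → N) : Prop :=
  ∀ ⦃j : Fin k⦄ ⦃a : M⦄ ⦃b : N⦄, p j = some (a, b) → v j = a ∧ w j = b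

/-- The empty position has no pebbled indices. [folklore] -/
theorem dom_empty : (empty : PebblePosition k M N).dom = ∅ := by
  simp [dom, empty]

/-- Pebbled indices after a move. [folklore] -/
theorem dom_update_subset (p : PebblePosition k M N) (i : Fin k) (a : M) (b : N) :
    dom (Function.update p i (some (a, b))) ⊆ insert i p.dom := by
  intro j hj
  simp only [dom, Finset.mem_filter, Finset.mem_univ, true_and] at hj
  by_cases h : j = i
  · simp [h]
  · rw [Function.update_of_ne h] at hj
    simp [dom, hj, h]

/-- The DEFAULT extension of a position on the `M` side (values `default` off the pebbles).
[folklore] -/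
noncomputable def extM [Nonempty M] (p : PebblePosition k M N) : Fin k → M :=
  fun j => ((p j).map Prod.fst).getD (Classical.arbitrary M)

/-- The default extension on the `N` side. [folklore] -/
noncomputable def extN [Nonempty N] (p : PebblePosition k M N) : Fin k → N :=
  fun j => ((p j).map Prod.snd).getD (Classical.arbitrary N)

/-- The default extensions extend. [folklore] -/
theorem extends_ext [Nonempty M] [Nonempty N] (p : PebblePosition k M N) :
    p.Extends p.extM p.extN := by
  intro j a b h
  simp [extM, extN, h]

end PebblePosition

/-- GAME ⇒ LOGIC along positions: if the full position `(v, w)` belongs to a winning strategy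
space, `(M, v)` and `(N, w)` satisfy the same `C^k` formulas (induction on formulas; the
counting quantifier is handled by Duplicator's bijection). [Hella 1996; Cai–Fürer–Immerman
1992, proof of Thm 5.2 ((3) ⇒ (2))] [folklore] -/
theorem PebbleStrategySpace.realize_iff_of_ofFun_mem (S : PebbleStrategySpace k M N)
    (hS : ∀ ⦃p⦄, p ∈ S.positions → p.IsPartialIso L) :
    ∀ (φ : CFormula L k) (v : Fin k → M) (w : Fin k → N),
      PebblePosition.ofFun v w ∈ S.positions → (φ.Realize v ↔ φ.Realize w)
  | .rel R t, v, w, h =>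
    (hS h).2 R (v ∘ t) (w ∘ t) fun j => PebblePosition.pebbled_ofFun v w (t j)
  | .equal i j, v, w, h =>
    (hS h).1 (PebblePosition.pebbled_ofFun v w i) (PebblePosition.pebbled_ofFun v w j)
  | .falsum, _, _, _ => Iff.rfl
  | .not φ, v, w, h => not_congr (realize_iff_of_ofFun_mem S hS φ v w h)
  | .and φ ψ, v, w, h =>
    and_congr (realize_iff_of_ofFun_mem S hS φ v w h) (realize_iff_of_ofFun_mem S hS ψ v w h)
  | .existsGE m i φ, v, w, h => by
    obtain ⟨f, hf⟩ := S.move h i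
    have key : ∀ a, φ.Realize (Function.update v i a) ↔ φ.Realize (Function.update w i (f a)) :=
      fun a => realize_iff_of_ofFun_mem S hS φ _ _
        (by rw [← PebblePosition.update_ofFun]; exact hf a)
    simp only [CFormula.Realize]
    have hset : {b : N | φ.Realize (Function.update w i b)} =
        f '' {a : M | φ.Realize (Function.update v i a)} := by
      ext b
      simp only [Set.mem_setOf_eq, Set.mem_image]
      constructor
      · intro hb
        exact ⟨f.symm b, by rw [key, Equiv.apply_symm_apply]; exact hb, f.apply_symm_apply b⟩
      · rintro ⟨a, ha, rfl⟩
        exact (key a).1 ha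
    rw [hset, f.injective.encard_image]

/-- From the empty position Duplicator's strategy space reaches a FULL position (Spoiler
places the pairs one by one). [folklore] -/
theorem PebbleStrategySpace.exists_ofFun_mem (S : PebbleStrategySpace k M N) (v₀ : Fin k → M) :
    ∃ (v : Fin k → M) (w : Fin k → N), PebblePosition.ofFun v w ∈ S.positions := by
  have key : ∀ t ≤ k, ∃ p ∈ S.positions, ∀ i : Fin k, (i : ℕ) < t → ((p i).isSome : Prop) := by
    intro t
    induction t with
    | zero => exact fun _ => ⟨_, S.empty_mem, fun i hi => (Nat.not_lt_zero _ hi).elim⟩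
    | succ t ih =>
      intro ht
      obtain ⟨p, hp, hsome⟩ := ih (Nat.le_of_succ_le ht)
      obtain ⟨f, hf⟩ := S.move hp ⟨t, ht⟩
      refine ⟨_, hf (v₀ ⟨t, ht⟩), fun i hi => ?_⟩
      rcases Nat.lt_succ_iff_lt_or_eq.1 hi with hlt | heq
      · have hne : i ≠ ⟨t, ht⟩ := fun h => by simp [h] at hlt
        rw [Function.update_of_ne hne]
        exact hsome i hlt
      · have : i = ⟨t, ht⟩ := Fin.ext heq
        subst this
        simp
  obtain ⟨p, hp, hsome⟩ := key k le_rfl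
  refine ⟨fun i => ((p i).get (hsome i i.isLt)).1, fun i => ((p i).get (hsome i i.isLt)).2, ?_⟩
  convert hp using 1
  funext i
  simp [PebblePosition.ofFun]

/-- **Hella's theorem, game ⇒ logic:** structures that are `≡_{C^k}` in the sense of the bijective
`k`-pebble game satisfy the same `C^k` sentences (any structures, any `k`). [Hella 1996;
Atserias–Dawar 2019, §2.1] [folklore] -/
theorem StructCkEquiv.ckSentenceEquiv (h : StructCkEquiv L k M N) : CkSentenceEquiv L k M N := by
  obtain ⟨S, hS⟩ := h
  intro φ hφ v w
  obtain ⟨v', w', hvw⟩ := S.exists_ofFun_mem v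
  exact (hφ.realize_iff v v').trans
    ((S.realize_iff_of_ofFun_mem hS φ v' w' hvw).trans (hφ.realize_iff w' w))

/-! #### Logic ⇒ game (finite structures): the strategy space of `C^k`-type-respecting positions -/

namespace CFormula

/-- Finite conjunction. [folklore] -/
def conj : List (CFormula L k) → CFormula L k
  | [] => not falsum
  | φ :: l => and φ (conj l)

/-- Semantics of the finite conjunction. [folklore] -/
@[simp] theorem realize_conj {M : Type w₁} [L.Structure M] (v : Fin k → M) :
    ∀ l : List (CFormula L k), (conj l).Realize v ↔ ∀ φ ∈ l, φ.Realize v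
  | [] => by simp [conj, Realize]
  | φ :: l => by simp [conj, Realize, realize_conj v l]

/-- Free variables of the finite conjunction. [folklore] -/
theorem freeVars_conj_subset {s : Finset (Fin k)} :
    ∀ l : List (CFormula L k), (∀ φ ∈ l, φ.freeVars ⊆ s) → (conj l).freeVars ⊆ s
  | [], _ => by simp [conj, freeVars]
  | φ :: l, h => by
    simp only [conj, freeVars]
    exact Finset.union_subset (h φ (by simp)) (freeVars_conj_subset l fun ψ hψ => h ψ (by simp [hψ]))

end CFormula

/-- Realisation of `φ` with variable `i` set to an element of `M ⊕ N` (the other variables at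
fixed assignments `vp`, `wp`). [folklore] -/
def realizeAt (vp : Fin k → M) (wp : Fin k → N) (i : Fin k) (φ : CFormula L k) : M ⊕ N → Prop
  | Sum.inl a => φ.Realize (Function.update vp i a)
  | Sum.inr b => φ.Realize (Function.update wp i b)

/-- The `C^k`-TYPE (over formulas with free variables in `s`) of an element of `M ⊕ N` placed at
variable `i`. [Libkin 2004, §11.? (FO^k types); Otto 2017] [folklore] -/
def typeAt (vp : Fin k → M) (wp : Fin k → N) (i : Fin k) (s : Finset (Fin k)) (x : M ⊕ N) :
    Set (CFormula L k) :=
  {φ | φ.freeVars ⊆ s ∧ realizeAt vp wp i φ x}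

/-- Negation commutes with `realizeAt`. [folklore] -/
theorem realizeAt_not (vp : Fin k → M) (wp : Fin k → N) (i : Fin k) (φ : CFormula L k)
    (x : M ⊕ N) : realizeAt vp wp i (CFormula.not φ) x ↔ ¬ realizeAt vp wp i φ x := by
  cases x <;> rfl

/-- Finite conjunction commutes with `realizeAt`. [folklore] -/
theorem realizeAt_conj (vp : Fin k → M) (wp : Fin k → N) (i : Fin k) (l : List (CFormula L k))
    (x : M ⊕ N) : realizeAt vp wp i (CFormula.conj l) x ↔ ∀ φ ∈ l, realizeAt vp wp i φ x := by
  cases x <;> exact CFormula.realize_conj _ l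

/-- On FINITE structures every `C^k`-type over `s` is defined by a single formula with free
variables in `s` (conjunction of finitely many distinguishing literals). [Cai–Fürer–Immerman
1992, Lemma 4.4 (finitely many inequivalent formulas on structures of a fixed finite size);
Libkin 2004, proof of Thm 11.5] [folklore] -/
theorem exists_formula_defining_typeAt [Finite M] [Finite N] (vp : Fin k → M) (wp : Fin k → N)
    (i : Fin k) (s : Finset (Fin k)) (x₀ : M ⊕ N) :
    ∃ ψ : CFormula L k, ψ.freeVars ⊆ s ∧
      ∀ x, realizeAt vp wp i ψ x ↔ typeAt (L := L) vp wp i s x = typeAt vp wp i s x₀ := by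
  classical
  -- a distinguishing formula for every pair of distinct types
  have hδ : ∀ y z : M ⊕ N, typeAt (L := L) vp wp i s y ≠ typeAt vp wp i s z →
      ∃ δ : CFormula L k, δ.freeVars ⊆ s ∧ ¬ (realizeAt vp wp i δ y ↔ realizeAt vp wp i δ z) := by
    intro y z hyz
    by_contra hcon
    push Not at hcon
    apply hyz
    ext φ
    simp only [typeAt, Set.mem_setOf_eq]
    exact ⟨fun ⟨h1, h2⟩ => ⟨h1, (hcon φ h1).1 h2⟩, fun ⟨h1, h2⟩ => ⟨h1, (hcon φ h1).2 h2⟩⟩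
  choose! δ hδs hδd using hδ
  -- literals as realised by `x₀`
  let lit : CFormula L k → CFormula L k := fun φ => if realizeAt vp wp i φ x₀ then φ else .not φ
  have hlit_fv : ∀ φ, (lit φ).freeVars = φ.freeVars := fun φ => by
    by_cases h : realizeAt vp wp i φ x₀ <;> simp [lit, h, CFormula.freeVars]
  have hlit : ∀ x φ, realizeAt vp wp i (lit φ) x ↔ (realizeAt vp wp i φ x ↔ realizeAt vp wp i φ x₀) := by
    intro x φ
    by_cases h : realizeAt vp wp i φ x₀
    · simp [lit, h]
    · simp [lit, h, realizeAt_not]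
  haveI := Fintype.ofFinite M
  haveI := Fintype.ofFinite N
  let pairs : List ((M ⊕ N) × (M ⊕ N)) :=
    (Finset.univ.filter fun yz : (M ⊕ N) × (M ⊕ N) =>
      typeAt (L := L) vp wp i s yz.1 ≠ typeAt vp wp i s yz.2).toList
  have hpairs : ∀ yz, yz ∈ pairs ↔ typeAt (L := L) vp wp i s yz.1 ≠ typeAt vp wp i s yz.2 := by
    intro yz; simp [pairs]
  refine ⟨CFormula.conj (pairs.map fun yz => lit (δ yz.1 yz.2)), ?_, fun x => ?_⟩
  · refine CFormula.freeVars_conj_subset _ fun φ hφ => ?_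
    obtain ⟨yz, hyz, rfl⟩ := List.mem_map.1 hφ
    rw [hlit_fv]
    exact hδs _ _ ((hpairs yz).1 hyz)
  · rw [realizeAt_conj]
    constructor
    · intro hall
      by_contra hne
      have hmem : (x₀, x) ∈ pairs := (hpairs (x₀, x)).2 (Ne.symm hne)
      have h1 := (hlit x _).1 (hall _ (List.mem_map.2 ⟨(x₀, x), hmem, rfl⟩))
      exact hδd x₀ x (Ne.symm hne) h1.symm
    · intro heq φ hφ
      obtain ⟨yz, hyz, rfl⟩ := List.mem_map.1 hφ
      rw [hlit]
      have hfv : (δ yz.1 yz.2).freeVars ⊆ s := hδs _ _ ((hpairs yz).1 hyz)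
      have := Set.ext_iff.1 heq (δ yz.1 yz.2)
      simp only [typeAt, Set.mem_setOf_eq, hfv, true_and] at this
      exact this

variable (L k M N) in
/-- The strategy space for LOGIC ⇒ GAME: positions all of whose extensions satisfy the same `C^k`
formulas with free variables among the pebbled indices. [Hella 1996; Cai–Fürer–Immerman 1992,
proof of Thm 5.2 ((1) ⇒ (3)); Libkin 2004, proof of Thm 11.5] [folklore] -/
def typePositions : Set (PebblePosition k M N) :=
  {p | ∀ φ : CFormula L k, φ.freeVars ⊆ p.dom → ∀ (v : Fin k → M) (w : Fin k → N),
    p.Extends v w → (φ.Realize v ↔ φ.Realize w)}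

/-- Positions in `typePositions` are partial isomorphisms. [folklore] -/
theorem isPartialIso_of_mem_typePositions [Nonempty M] [Nonempty N] {p : PebblePosition k M N}
    (hp : p ∈ typePositions L k M N) : p.IsPartialIso L := by
  classical
  have hext := p.extends_ext
  have hdom : ∀ {j a b}, p j = some (a, b) → j ∈ p.dom := fun h => by
    simp [PebblePosition.dom, h]
  refine ⟨fun a a' b b' ⟨j, hj⟩ ⟨j', hj'⟩ => ?_, fun r R a b hab => ?_⟩
  · have h := hp (.equal j j') (by
      intro x hx
      simp only [CFormula.freeVars, Finset.mem_insert, Finset.mem_singleton] at hx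
      rcases hx with rfl | rfl
      exacts [hdom hj, hdom hj']) p.extM p.extN hext
    simp only [CFormula.Realize] at h
    rwa [(hext hj).1, (hext hj').1, (hext hj).2, (hext hj').2] at h
  · choose t ht using hab
    have h := hp (.rel R t) (by
      intro x hx
      simp only [CFormula.freeVars, Finset.mem_image, Finset.mem_univ, true_and] at hx
      obtain ⟨j, rfl⟩ := hx
      exact hdom (ht j)) p.extM p.extN hext
    simp only [CFormula.Realize] at h
    have ha : p.extM ∘ t = a := funext fun j => (hext (ht j)).1
    have hb : p.extN ∘ t = b := funext fun j => (hext (ht j)).2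
    rwa [ha, hb] at h

/-- The bijective move inside `typePositions` (finite structures): the `C^k`-type classes of the
element to be pebbled next have the same sizes in `M` and `N` — by the counting quantifiers —
so Duplicator has a type-preserving bijection. [Hella 1996; Cai–Fürer–Immerman 1992, proof of
Thm 5.2 ((1) ⇒ (3))] [folklore] -/
theorem typePositions_move [Finite M] [Finite N] [Nonempty M] [Nonempty N]
    {p : PebblePosition k M N} (hp : p ∈ typePositions L k M N) (i : Fin k) :
    ∃ f : M ≃ N, ∀ a : M, Function.update p i (some (a, f a)) ∈ typePositions L k M N := by
  classical
  have hext := p.extends_ext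
  set vp := p.extM
  set wp := p.extN
  let s : Finset (Fin k) := insert i p.dom
  let T : M ⊕ N → Set (CFormula L k) := typeAt (L := L) vp wp i s
  -- (1) type classes over `s` at variable `i` have equal sizes in `M` and `N`
  have hfib : ∀ τ : Set (CFormula L k),
      Nonempty ({a : M // T (Sum.inl a) = τ} ≃ {b : N // T (Sum.inr b) = τ}) := by
    intro τ
    by_cases hτ : ∃ x₀, T x₀ = τ
    · obtain ⟨x₀, rfl⟩ := hτ
      obtain ⟨ψ, hψs, hψ⟩ := exists_formula_defining_typeAt (L := L) vp wp i s x₀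
      -- the counting sentences `∃^{≥ m} xᵢ ψ` have free variables in `dom p`
      have hcount : ∀ m : ℕ, ((m : ℕ∞) ≤ {a : M | ψ.Realize (Function.update vp i a)}.encard ↔
          (m : ℕ∞) ≤ {b : N | ψ.Realize (Function.update wp i b)}.encard) := fun m =>
        hp (.existsGE m i ψ) (by
          intro j hj
          simp only [CFormula.freeVars, Finset.mem_erase] at hj
          have := hψs hj.2
          simp only [s, Finset.mem_insert] at this
          exact this.resolve_left hj.1) vp wp hext
      have hcard : {a : M | ψ.Realize (Function.update vp i a)}.encard =
          {b : N | ψ.Realize (Function.update wp i b)}.encard :=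
        le_antisymm (ENat.forall_natCast_le_iff_le.1 fun m hm => (hcount m).1 hm)
          (ENat.forall_natCast_le_iff_le.1 fun m hm => (hcount m).2 hm)
      have hnat : Nat.card {a : M | ψ.Realize (Function.update vp i a)} =
          Nat.card {b : N | ψ.Realize (Function.update wp i b)} := by
        rw [Set.encard, Set.encard, ENat.card_eq_coe_natCard, ENat.card_eq_coe_natCard] at hcard
        exact_mod_cast hcard
      obtain ⟨e⟩ := Finite.card_eq.1 hnat
      refine ⟨(Equiv.subtypeEquivRight fun a => ?_).trans
        (e.trans (Equiv.subtypeEquivRight fun b => ?_))⟩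
      · exact (hψ (Sum.inl a)).symm
      · exact hψ (Sum.inr b)
    · push Not at hτ
      haveI : IsEmpty {a : M // T (Sum.inl a) = τ} := ⟨fun a => hτ _ a.2⟩
      haveI : IsEmpty {b : N // T (Sum.inr b) = τ} := ⟨fun b => hτ _ b.2⟩
      exact ⟨Equiv.equivOfIsEmpty _ _⟩
  have e := fun τ => (hfib τ).some
  let f : M ≃ N := Equiv.ofFiberEquiv (f := fun a => T (Sum.inl a)) (g := fun b => T (Sum.inr b)) e
  have hf : ∀ a, T (Sum.inr (f a)) = T (Sum.inl a) := fun a =>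
    Equiv.ofFiberEquiv_map (f := fun a => T (Sum.inl a)) (g := fun b => T (Sum.inr b)) e a
  refine ⟨f, fun a φ hφ v w hvw => ?_⟩
  -- (2) the new position is again type-respecting
  have hφs : φ.freeVars ⊆ s := hφ.trans (p.dom_update_subset i a (f a))
  have hvi : v i = a ∧ w i = f a := hvw (by simp)
  have hagree : ∀ j ∈ φ.freeVars, v j = Function.update vp i a j ∧
      w j = Function.update wp i (f a) j := by
    intro j hj
    by_cases hji : j = i
    · subst hji; simpa using hvi
    · rw [Function.update_of_ne hji, Function.update_of_ne hji]
      have hjdom : j ∈ p.dom := by simpa [s, hji] using hφs hj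
      simp only [PebblePosition.dom, Finset.mem_filter, Finset.mem_univ, true_and] at hjdom
      obtain ⟨⟨a', b'⟩, hj'⟩ := Option.isSome_iff_exists.1 hjdom
      have h1 := hvw (j := j) (a := a') (b := b') (by rw [Function.update_of_ne hji, hj'])
      exact ⟨h1.1.trans (hext hj').1.symm, h1.2.trans (hext hj').2.symm⟩
  rw [CFormula.realize_congr φ fun j hj => (hagree j hj).1,
    CFormula.realize_congr φ fun j hj => (hagree j hj).2]
  have := Set.ext_iff.1 (hf a) φ
  simp only [T, typeAt, Set.mem_setOf_eq, hφs, true_and] at this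
  exact this.symm

/-- **Hella's theorem, logic ⇒ game (finite structures):** finite nonempty `L`-structures
satisfying the same `C^k` sentences are `≡_{C^k}` in the sense of the bijective `k`-pebble game.
[Hella 1996; Atserias–Dawar 2019, §2.1; Cai–Fürer–Immerman 1992, Thm 5.2] [folklore] -/
theorem CkSentenceEquiv.structCkEquiv [Finite M] [Finite N] [Nonempty M] [Nonempty N]
    (h : CkSentenceEquiv L k M N) : StructCkEquiv L k M N := by
  refine ⟨⟨typePositions L k M N, ?_, fun p hp i => typePositions_move hp i⟩,
    fun p hp => isPartialIso_of_mem_typePositions hp⟩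
  intro φ hφ v w _
  rw [PebblePosition.dom_empty, Finset.subset_empty] at hφ
  exact h φ hφ v w

/-- **HELLA'S THEOREM.** For finite nonempty structures: Duplicator wins the bijective
`k`-pebble game (`StructCkEquiv`, this tree's `≡_{C^k}`) iff the structures satisfy the same
sentences of the `k`-variable counting logic `C^k` (`CkSentenceEquiv`). (Hella states it for
`C^k_{∞ω}` and arbitrary structures; on finite structures `C^k_{∞ω}`- and `C^k`-equivalence
coincide, and this finitary form is the one used in the cited literature. Both sides read
`L` relationally — function symbols are inspected by neither — so this is the printed theorem
for relational vocabularies.) [Hella 1996; Atserias–Dawar 2019, §2.1 ("𝔄 ≡_{C^k} 𝔅 if, and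
only if, Duplicator has a winning strategy in the k-pebble bijective game"); Cai–Fürer–Immerman
1992, Thms 4.5, 5.2] [cite: Hella1996, Theorem (bijective k-pebble game)] -/
theorem structCkEquiv_iff_ckSentenceEquiv [Finite M] [Finite N] [Nonempty M] [Nonempty N] :
    StructCkEquiv L k M N ↔ CkSentenceEquiv L k M N :=
  ⟨StructCkEquiv.ckSentenceEquiv, CkSentenceEquiv.structCkEquiv⟩

/-- **For graphs: the tree's `CkEquiv` IS `C^k`-equivalence.** Finite nonempty simple graphs are
`CkEquiv k` (Duplicator wins the bijective `k`-pebble game, `CkEquiv.lean`) iff, as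
`Language.graph`-structures, they satisfy the same `C^k` sentences. [Hella 1996; Grohe–Otto
2015, Thm 2.2; Atserias–Dawar 2019, §2.1] [folklore] -/
theorem ckEquiv_iff_ckSentenceEquiv {V : Type w₁} {W : Type w₂} [Finite V] [Finite W]
    [Nonempty V] [Nonempty W] (k : ℕ) (G : SimpleGraph V) (H : SimpleGraph W) :
    CkEquiv k G H ↔
      @CkSentenceEquiv FirstOrder.Language.graph k V W G.structure H.structure :=
  (ckEquiv_iff_structCkEquiv k G H).trans
    (@structCkEquiv_iff_ckSentenceEquiv FirstOrder.Language.graph k V W G.structure H.structure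
      _ _ _ _)

/-! #### Consequences: `≡_{C^k}` is an equivalence relation (finite structures) -/

/-- `CkSentenceEquiv` is symmetric. [folklore] -/
theorem CkSentenceEquiv.symm (h : CkSentenceEquiv L k M N) : CkSentenceEquiv L k N M :=
  fun φ hφ w v => (h φ hφ v w).symm

/-- `CkSentenceEquiv` is transitive (through a nonempty middle structure, so that assignments
exist). [folklore] -/
theorem CkSentenceEquiv.trans {P : Type w₁} [L.Structure P] [Nonempty N]
    (h₁ : CkSentenceEquiv L k M N) (h₂ : CkSentenceEquiv L k N P) : CkSentenceEquiv L k M P :=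
  fun φ hφ v u => (h₁ φ hφ v fun _ => Classical.arbitrary N).trans
    (h₂ φ hφ (fun _ => Classical.arbitrary N) u)

/-- `StructCkEquiv` is symmetric on finite nonempty structures (via Hella's theorem). [folklore] -/
theorem StructCkEquiv.symm [Finite M] [Finite N] [Nonempty M] [Nonempty N]
    (h : StructCkEquiv L k M N) : StructCkEquiv L k N M :=
  h.ckSentenceEquiv.symm.structCkEquiv

/-- `StructCkEquiv` is transitive on finite nonempty structures (via Hella's theorem).
[folklore] -/
theorem StructCkEquiv.trans {P : Type w₁} [L.Structure P] [Finite M] [Finite N] [Finite P]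
    [Nonempty M] [Nonempty N] [Nonempty P] (h₁ : StructCkEquiv L k M N)
    (h₂ : StructCkEquiv L k N P) : StructCkEquiv L k M P :=
  (h₁.ckSentenceEquiv.trans h₂.ckSentenceEquiv).structCkEquiv

/-- **Transitivity of the tree's `CkEquiv`** for finite nonempty graphs (deferred in
`CkEquiv.lean`; here through Hella's theorem: agreement on `C^k` sentences is transitive).
[folklore] -/
theorem CkEquiv.trans {V : Type w₁} {W : Type w₂} {X : Type w₁} [Finite V] [Finite W] [Finite X]
    [Nonempty V] [Nonempty W] [Nonempty X] {G : SimpleGraph V} {H : SimpleGraph W}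
    {K : SimpleGraph X} (h₁ : CkEquiv k G H) (h₂ : CkEquiv k H K) : CkEquiv k G K := by
  rw [ckEquiv_iff_ckSentenceEquiv] at h₁ h₂ ⊢
  exact @CkSentenceEquiv.trans FirstOrder.Language.graph k V W G.structure H.structure X
    K.structure _ h₁ h₂

end Hella

/-! ### Definability by `C^k` sentences versus `≡_{C^k}`-invariance (finite vocabulary of graphs)

The form in which Atserias–Dawar–Ochremiak and Dawar–Wang state counting-width bounds ("every
`C^k` sentence defining the class on `n`-vertex graphs has `k ≥ …`") and the game form used in
`CountingWidth.lean` ("two `≡_{C^k}` graphs on `n` vertices, one in the class and one not") are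
EQUIVALENT: on the finitely many graphs with vertex set `Fin n`, a class is defined by a `C^k`
sentence iff it is a union of `≡_{C^k}`-classes (Atserias–Dawar 2019, §2.1: "k(n) is also the
smallest value such that 𝒞ₙ is a union of ≡_{C^{k(n)}}-classes"). -/

section Definability

open CFormula

variable {k : ℕ}

/-- Disjunction in `C^k` (`φ ∨ ψ := ¬(¬φ ∧ ¬ψ)`, no new variables). [folklore] -/
def CFormula.or {L : FirstOrder.Language.{u', v'}} (φ ψ : CFormula L k) : CFormula L k :=
  .not (.and (.not φ) (.not ψ))

/-- Semantics of the disjunction. [folklore] -/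
@[simp] theorem CFormula.realize_or {L : FirstOrder.Language.{u', v'}} {M : Type w₁} [L.Structure M]
    (φ ψ : CFormula L k) (v : Fin k → M) : (φ.or ψ).Realize v ↔ φ.Realize v ∨ ψ.Realize v := by
  simp only [CFormula.or, Realize]
  tauto

/-- Finite disjunction. [folklore] -/
def CFormula.disj {L : FirstOrder.Language.{u', v'}} : List (CFormula L k) → CFormula L k
  | [] => .falsum
  | φ :: l => φ.or (CFormula.disj l)

/-- Semantics of the finite disjunction. [folklore] -/
@[simp] theorem CFormula.realize_disj {L : FirstOrder.Language.{u', v'}} {M : Type w₁}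
    [L.Structure M] (v : Fin k → M) :
    ∀ l : List (CFormula L k), (CFormula.disj l).Realize v ↔ ∃ φ ∈ l, φ.Realize v
  | [] => by simp [CFormula.disj, Realize]
  | φ :: l => by simp [CFormula.disj, CFormula.realize_disj v l]

/-- Free variables of the finite disjunction. [folklore] -/
theorem CFormula.freeVars_disj_subset {L : FirstOrder.Language.{u', v'}} {s : Finset (Fin k)} :
    ∀ l : List (CFormula L k), (∀ φ ∈ l, φ.freeVars ⊆ s) → (CFormula.disj l).freeVars ⊆ s
  | [], _ => by simp [CFormula.disj, freeVars]
  | φ :: l, h => by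
    simp only [CFormula.disj, CFormula.or, freeVars]
    exact Finset.union_subset (h φ (by simp))
      (CFormula.freeVars_disj_subset l fun ψ hψ => h ψ (by simp [hψ]))

/-- `G ⊨ φ` for a graph `G` on `Fin n` (`n ≥ 1`) and a `C^k` formula of the language of graphs, read
at the constant assignment `x ↦ 0` (immaterial for sentences, `IsSentence.realize_iff`).
[folklore] -/
def GraphModels {n : ℕ} (hn : 0 < n) (G : SimpleGraph (Fin n))
    (φ : CFormula FirstOrder.Language.graph k) : Prop :=
  @CFormula.Realize _ _ (Fin n) G.structure φ fun _ => ⟨0, hn⟩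

/-- A `C^k` sentence `φ` DEFINES the class `𝒞` ON `n`-VERTEX GRAPHS: for every graph `G` with
vertex set `Fin n`, `G ⊨ φ ↔ G ∈ 𝒞`. [Atserias–Dawar–Ochremiak 2021, §5.1 ("a C^k-formula that
defines 𝒞ₙ on L-structures of cardinality n"); Dawar–Wang 2017, Def. 12] [folklore] -/
def DefinesOn {n : ℕ} (hn : 0 < n) (φ : CFormula FirstOrder.Language.graph k)
    (𝒞 : Set (SimpleGraph (Fin n))) : Prop :=
  φ.IsSentence ∧ ∀ G : SimpleGraph (Fin n), GraphModels hn G φ ↔ G ∈ 𝒞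

/-- **Definable by a `C^k` sentence on `n`-vertex graphs iff a union of `≡_{C^k}`-classes.**
For `n ≥ 1` and a class `𝒞` of graphs on `Fin n`: some `C^k` sentence defines `𝒞` on `n`-vertex
graphs iff `𝒞` is `CkEquiv k`-invariant (whenever `G ≡_{C^k} H`, `G ∈ 𝒞 ↔ H ∈ 𝒞`). (→) is Hella's
theorem; (←): there are finitely many graphs on `Fin n`, inequivalent ones are separated by a
sentence (Hella), and `𝒞` is defined by `⋁_{G ∈ 𝒞} ⋀_{H ∉ 𝒞} δ_{G,H}`. This is the passage
between the printed "every `C^k` sentence defining the class has `k ≥ …`" (Atserias–Dawar–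
Ochremiak 2021, Lemmas 13–14; Dawar–Wang 2017) and the witness form "two `≡_{C^k}` graphs, one
in the class and one not" used in `CountingWidth.lean`. [Atserias–Dawar 2019, §2.1 ("k(n) is also
the smallest value such that 𝒞ₙ is a union of ≡_{C^{k(n)}}-classes")] [folklore] -/
theorem exists_definesOn_iff_ckEquiv_invariant {n : ℕ} (hn : 0 < n)
    (𝒞 : Set (SimpleGraph (Fin n))) :
    (∃ φ : CFormula FirstOrder.Language.graph k, DefinesOn hn φ 𝒞) ↔
      ∀ G H : SimpleGraph (Fin n), CkEquiv k G H → (G ∈ 𝒞 ↔ H ∈ 𝒞) := by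
  classical
  haveI : Nonempty (Fin n) := ⟨⟨0, hn⟩⟩
  constructor
  · rintro ⟨φ, hφs, hφ⟩ G H hGH
    rw [← hφ G, ← hφ H]
    exact (ckEquiv_iff_ckSentenceEquiv k G H).1 hGH φ hφs _ _
  · intro hinv
    -- a separating sentence for every pair `G ∈ 𝒞`, `H ∉ 𝒞`, true in `G` and false in `H`
    have hsep : ∀ G H : SimpleGraph (Fin n), G ∈ 𝒞 → H ∉ 𝒞 →
        ∃ δ : CFormula FirstOrder.Language.graph k, δ.IsSentence ∧
          GraphModels hn G δ ∧ ¬ GraphModels hn H δ := by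
      intro G H hG hH
      have hne : ¬ CkEquiv k G H := fun h => hH ((hinv G H h).1 hG)
      rw [ckEquiv_iff_ckSentenceEquiv] at hne
      simp only [CkSentenceEquiv, not_forall] at hne
      obtain ⟨δ, hδs, v, w, hvw⟩ := hne
      have hv : @CFormula.Realize _ _ (Fin n) G.structure δ v ↔ GraphModels hn G δ :=
        @CFormula.IsSentence.realize_iff _ _ (Fin n) G.structure δ hδs v _
      have hw : @CFormula.Realize _ _ (Fin n) H.structure δ w ↔ GraphModels hn H δ :=
        @CFormula.IsSentence.realize_iff _ _ (Fin n) H.structure δ hδs w _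
      by_cases hGδ : GraphModels hn G δ
      · refine ⟨δ, hδs, hGδ, fun hHδ => hvw ?_⟩
        rw [hv, hw]
        exact iff_of_true hGδ hHδ
      · refine ⟨.not δ, by simpa [CFormula.IsSentence, freeVars] using hδs, hGδ, ?_⟩
        intro hHδ
        apply hvw
        rw [hv, hw]
        exact iff_of_false hGδ hHδ
    choose! δ hδs hδG hδH using hsep
    haveI : Fintype (SimpleGraph (Fin n)) := inferInstance
    let inC : List (SimpleGraph (Fin n)) := (Finset.univ.filter (· ∈ 𝒞)).toList
    let outC : List (SimpleGraph (Fin n)) := (Finset.univ.filter (· ∉ 𝒞)).toList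
    have hinC : ∀ G, G ∈ inC ↔ G ∈ 𝒞 := fun G => by simp [inC]
    have houtC : ∀ H, H ∈ outC ↔ H ∉ 𝒞 := fun H => by simp [outC]
    refine ⟨CFormula.disj (inC.map fun G => CFormula.conj (outC.map fun H => δ G H)), ?_, fun K => ?_⟩
    · -- a sentence
      show CFormula.freeVars _ = ∅
      refine Finset.subset_empty.1 (CFormula.freeVars_disj_subset _ fun φ hφ => ?_)
      obtain ⟨G, hG, rfl⟩ := List.mem_map.1 hφ
      refine CFormula.freeVars_conj_subset _ fun ψ hψ => ?_
      obtain ⟨H, hH, rfl⟩ := List.mem_map.1 hψ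
      exact Finset.subset_empty.2 (hδs G H ((hinC G).1 hG) ((houtC H).1 hH))
    · -- it defines `𝒞`
      simp only [GraphModels, CFormula.realize_disj, CFormula.realize_conj, List.mem_map,
        exists_exists_and_eq_and, forall_exists_index, and_imp, forall_apply_eq_imp_iff₂]
      constructor
      · rintro ⟨G, hG, hall⟩
        by_contra hK
        exact hδH G K ((hinC G).1 hG) hK (hall K ((houtC K).2 hK))
      · intro hK
        exact ⟨K, (hinC K).2 hK, fun H hH => hδG K H hK ((houtC H).1 hH)⟩

end Definability

end Literature.ModelTheory.FiniteModelTheory
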